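import Summits.RiemannHypothesis.RiemannHypothesis.Theorems.SemilocalDeletionAnimalFloor
import Summits.RiemannHypothesis.RiemannHypothesis.Theorems.SemilocalDeletionAnimalBlocks
import Summits.RiemannHypothesis.RiemannHypothesis.Theorems.SemilocalDeletionAnimalWindows
import HarnessLib

/-!
# BLOCK CERTIFICATES ⇒ CONTINUUM FLOOR: the theorem behind the certified lattice engine («lineage Lc»)

Glue of `SemilocalDeletionAnimalFloor` (animal certificate ⇒ floor), `SemilocalDeletionAnimalBlocks` (IMS block reduction) and
`SemilocalDeletionAnimalWindows` (cosine windows).  Fix a slicing prime `s ∈ T` and a block length `2ℓ` (`ℓ ≥ N`, `ℓ ≥ 1`).  If EVERY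
vector `G` supported on a BLOCK — a slab configuration (positions `u + Σ k_p log p ∈ [−c, c]`) whose `s`-coordinates lie in an interval
`[a, a + 2ℓ]` — satisfies `μ Σ|G_k|² + LF(G) ≥ 0`, then (§1) the full lattice certificate holds with constant
`μ + Σ_{n ≤ N} |w_n|·3(π v_s(n)/(2ℓ))²` and hence (§2) for every Weil test function `g ∈ C(c)` and any finite `S, S'` with `T ⊇` primes of
`S ∆ S'`:  `Re Q_{S'}(g) ≥ Re Q_S(g) − (μ + 3(π/2ℓ)² Σ_n |w_n| v_s(n)²)·‖g‖₂²`, `w_n = (Λ_S − Λ_{S'})(n) n^{-1/2}`, `v_s(n)` = exponent of `s` in `n`.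
Blocks are finite objects, so the constant is CERTIFIABLE by finitely many finite eigenvalue enclosures — cc-s2-1 gen17's deposit
`EXTREMALS/semilocal/Sp-animal-Lc-v1` (23 pair windows, bracket widths ≈ 1e−6).  Nothing here bears on RH.
-/

set_option linter.dupNamespace false

noncomputable section

open Complex Filter Set MeasureTheory Finset
open scoped Real Topology ComplexConjugate

namespace Summit.RiemannHypothesis.RiemannHypothesis.Theorems.SemilocalDeletionAnimalCert

open Literature.NumberTheory.LFunctions
open Summit.RiemannHypothesis.RiemannHypothesis.Theorems.SemilocalDeletionAnimalFloor
open Summit.RiemannHypothesis.RiemannHypothesis.Theorems.SemilocalDeletionAnimalBlocks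
open Summit.RiemannHypothesis.RiemannHypothesis.Theorems.SemilocalDeletionAnimalWindows

variable {g : ℝ → ℂ} {c : ℝ} {N : ℕ} {S S' : Finset ℕ}

/-! ## §1  Lattice level: block certificates along one coordinate ⇒ the full certificate -/

/-- **Block certificates ⇒ lattice certificate** (cosine windows of length `2ℓ` along the coordinate `s`; price
`Σ_n |w_n|·3(π v_s(n)/(2ℓ))²`).  Pure lattice statement: `T` any finite set, shifts = exponent vectors. -/
theorem latticeCert_of_blockCert {T : Finset ℕ} (s : T) (w : ℕ → ℝ) {ℓ : ℕ} (hℓ : N ≤ ℓ) (hℓ0 : 0 < ℓ) {μ : ℝ}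
    (hblock : ∀ (u : ℝ) (a : ℤ) (F : Finset (T → ℤ)) (G : (T → ℤ) → ℂ), (∀ k, k ∉ F → G k = 0) →
      (∀ k ∈ F, u + ∑ p : T, (k p : ℝ) * Real.log ((p : ℕ) : ℝ) ∈ Icc (-c) c) → (∀ k ∈ F, a ≤ k s ∧ k s ≤ a + 2 * ℓ) →
      0 ≤ μ * ∑ k ∈ F, ‖G k‖ ^ 2 + ∑ n ∈ Finset.range (N + 1), w n *
        ∑ k ∈ F, (G (k + fun p : T ↦ ((n.factorization p : ℕ) : ℤ)) * conj (G k) +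
          G k * conj (G (k + fun p : T ↦ ((n.factorization p : ℕ) : ℤ)))).re)
    (u : ℝ) (F : Finset (T → ℤ)) (G : (T → ℤ) → ℂ) (hGF : ∀ k, k ∉ F → G k = 0)
    (hFw : ∀ k ∈ F, u + ∑ p : T, (k p : ℝ) * Real.log ((p : ℕ) : ℝ) ∈ Icc (-c) c) :
    0 ≤ (μ + ∑ n ∈ Finset.range (N + 1), |w n| * (3 * (π / 2 * (((n.factorization (s : ℕ) : ℕ) : ℝ) / ℓ)) ^ 2)) *
        ∑ k ∈ F, ‖G k‖ ^ 2 + ∑ n ∈ Finset.range (N + 1), w n *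
        ∑ k ∈ F, (G (k + fun p : T ↦ ((n.factorization p : ℕ) : ℤ)) * conj (G k) +
          G k * conj (G (k + fun p : T ↦ ((n.factorization p : ℕ) : ℤ)))).re := by
  classical
  have hℓr : (0 : ℝ) < ℓ := by exact_mod_cast hℓ0
  -- window index range covering F
  let J : Finset ℤ := (F.image fun k ↦ ⌊((k s : ℤ) : ℝ) / ℓ⌋) ∪ (F.image fun k ↦ ⌊((k s : ℤ) : ℝ) / ℓ⌋ + 1)
  have hJ0 : ∀ k ∈ F, ⌊((k s : ℤ) : ℝ) / ℓ⌋ ∈ J := fun k hk ↦ Finset.mem_union_left _ (Finset.mem_image.2 ⟨k, hk, rfl⟩)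
  have hJ1 : ∀ k ∈ F, ⌊((k s : ℤ) : ℝ) / ℓ⌋ + 1 ∈ J := fun k hk ↦ Finset.mem_union_right _ (Finset.mem_image.2 ⟨k, hk, rfl⟩)
  refine latticeCert_of_blocks J (fun j k ↦ Real.cos (π / 2 * max (-1) (min 1 (((k s : ℤ) : ℝ) / ℓ - j)))) F G w
    (fun n ↦ fun p : T ↦ ((n.factorization p : ℕ) : ℤ)) N hGF (fun k hk ↦ ?_) (fun n _ ↦ by positivity) (fun n hn k _ _ ↦ ?_)
    (fun j _ ↦ ?_)
  · -- partition of unity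
    exact sum_cosWindow_sq_eq_one _ (hJ0 k hk) (hJ1 k hk)
  · -- gradient bound: the shift moves k_s/ℓ by v_s(n)/ℓ ∈ [0, 1]
    have hv0 : (0 : ℝ) ≤ ((n.factorization (s : ℕ) : ℕ) : ℝ) / ℓ := by positivity
    have hv1 : ((n.factorization (s : ℕ) : ℕ) : ℝ) / ℓ ≤ 1 := by
      rw [div_le_one hℓr]
      have h1 : n.factorization (s : ℕ) ≤ n := by
        rcases Nat.eq_zero_or_pos n with h0 | h0
        · simp [h0]
        · exact (Nat.factorization_lt (s : ℕ) h0.ne').le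
      exact_mod_cast h1.trans ((Nat.lt_succ_iff.1 (Finset.mem_range.1 hn)).trans hℓ)
    have e : ∀ j : ℤ, (((k + fun p : T ↦ ((n.factorization p : ℕ) : ℤ)) s : ℤ) : ℝ) / ℓ - j =
        ((k s : ℤ) : ℝ) / ℓ + ((n.factorization (s : ℕ) : ℕ) : ℝ) / ℓ - j := by
      intro j; simp only [Pi.add_apply, Int.cast_add, Int.cast_natCast, add_div]
    calc ∑ j ∈ J, (Real.cos (π / 2 * max (-1) (min 1 ((((k + fun p : T ↦ ((n.factorization p : ℕ) : ℤ)) s : ℤ) : ℝ) / ℓ - j)))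
            - Real.cos (π / 2 * max (-1) (min 1 (((k s : ℤ) : ℝ) / ℓ - j)))) ^ 2
        = ∑ j ∈ J, (Real.cos (π / 2 * max (-1) (min 1 (((k s : ℤ) : ℝ) / ℓ + ((n.factorization (s : ℕ) : ℕ) : ℝ) / ℓ - j)))
            - Real.cos (π / 2 * max (-1) (min 1 (((k s : ℤ) : ℝ) / ℓ - j)))) ^ 2 := by
          refine Finset.sum_congr rfl fun j _ ↦ ?_; rw [e j]
      _ ≤ 3 * (π / 2 * (((n.factorization (s : ℕ) : ℕ) : ℝ) / ℓ)) ^ 2 := sum_cosWindow_sub_sq_le _ hv0 hv1 J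
  · -- every localised vector satisfies the block certificate: it vanishes off the block a = ℓ(j-1) … a + 2ℓ
    have hvan : ∀ k, k ∉ F.filter (fun k ↦ (ℓ : ℤ) * (j - 1) ≤ k s ∧ k s ≤ (ℓ : ℤ) * (j - 1) + 2 * ℓ) →
        (Real.cos (π / 2 * max (-1) (min 1 (((k s : ℤ) : ℝ) / ℓ - j))) : ℂ) * G k = 0 := by
      intro k hk
      by_cases hkF : k ∈ F
      · have hks : ¬ ((ℓ : ℤ) * (j - 1) ≤ k s ∧ k s ≤ (ℓ : ℤ) * (j - 1) + 2 * ℓ) := fun h ↦ hk (Finset.mem_filter.2 ⟨hkF, h⟩)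
        have h0 : Real.cos (π / 2 * max (-1) (min 1 (((k s : ℤ) : ℝ) / ℓ - j))) = 0 := by
          rcases not_and_or.1 hks with h1 | h2
          · refine cosWindow_eq_zero_of_le_neg_one ?_
            have : ((k s : ℤ) : ℝ) ≤ (ℓ : ℝ) * (j - 1) - 1 := by exact_mod_cast Int.le_sub_one_of_lt (not_le.1 h1)
            have : ((k s : ℤ) : ℝ) / ℓ ≤ (j - 1) - 1 / ℓ := by
              rw [div_le_iff₀ hℓr, sub_mul, div_mul_cancel₀ _ (ne_of_gt hℓr)]; linarith
            have : (0 : ℝ) < 1 / ℓ := by positivity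
            linarith
          · refine cosWindow_eq_zero_of_one_le ?_
            have : (ℓ : ℝ) * (j - 1) + 2 * ℓ + 1 ≤ ((k s : ℤ) : ℝ) := by exact_mod_cast Int.add_one_le_of_lt (not_le.1 h2)
            have : (j - 1) + 2 + 1 / ℓ ≤ ((k s : ℤ) : ℝ) / ℓ := by
              rw [le_div_iff₀ hℓr, add_mul, add_mul, div_mul_cancel₀ _ (ne_of_gt hℓr)]; linarith
            have : (0 : ℝ) < 1 / ℓ := by positivity
            linarith
        rw [h0]; simp
      · rw [hGF k hkF, mul_zero]
    have hsub : F.filter (fun k ↦ (ℓ : ℤ) * (j - 1) ≤ k s ∧ k s ≤ (ℓ : ℤ) * (j - 1) + 2 * ℓ) ⊆ F := Finset.filter_subset _ _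
    have h := hblock u ((ℓ : ℤ) * (j - 1)) _ (fun k ↦ (Real.cos (π / 2 * max (-1) (min 1 (((k s : ℤ) : ℝ) / ℓ - j))) : ℂ) * G k)
      hvan (fun k hk ↦ hFw k (hsub hk)) (fun k hk ↦ (Finset.mem_filter.1 hk).2)
    rw [Finset.sum_subset hsub (fun k _ hk ↦ by rw [hvan k hk, norm_zero, zero_pow two_ne_zero])] at h
    refine h.trans_eq ?_
    congr 1
    refine Finset.sum_congr rfl fun n _ ↦ ?_
    congr 1
    exact Finset.sum_subset hsub fun k _ hk ↦ by rw [hvan k hk]; simp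

/-! ## §2  Continuum: block certificates ⇒ floor -/

/-- **BLOCK CERTIFICATES ⇒ CONTINUUM FLOOR.**  `S, S'` finite, `T ⊇` primes of `S ∆ S'`, `g ∈ C(c)` a Weil test function, `2c < log(N+1)`,
`s ∈ T` the slicing prime, `ℓ ≥ max(N, 1)`.  A certificate constant `μ` valid on every slab block of `s`-length `2ℓ` gives
`Re Q_{S'}(g) ≥ Re Q_S(g) − (μ + Σ_{n ≤ N} |w_n|·3(π v_s(n)/(2ℓ))²)·‖g‖₂²`. -/
theorem re_weilSemilocalQuadratic_ge_of_blockCert {T : Finset ℕ} (hT : ∀ p, p.Prime → p ∈ S → p ∉ S' → p ∈ T)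
    (hT' : ∀ p, p.Prime → p ∈ S' → p ∉ S → p ∈ T) (hg : IsWeilTest g) (hsupp : tsupport g ⊆ Icc (-c) c)
    (hN : 2 * c < Real.log ((N : ℝ) + 1)) (s : T) {ℓ : ℕ} (hℓ : N ≤ ℓ) (hℓ0 : 0 < ℓ) {μ : ℝ}
    (hblock : ∀ (u : ℝ) (a : ℤ) (F : Finset (T → ℤ)) (G : (T → ℤ) → ℂ), (∀ k, k ∉ F → G k = 0) →
      (∀ k ∈ F, u + ∑ p : T, (k p : ℝ) * Real.log ((p : ℕ) : ℝ) ∈ Icc (-c) c) → (∀ k ∈ F, a ≤ k s ∧ k s ≤ a + 2 * ℓ) →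
      0 ≤ μ * ∑ k ∈ F, ‖G k‖ ^ 2 + ∑ n ∈ Finset.range (N + 1), (weilSemilocalCoeff S n - weilSemilocalCoeff S' n) *
        ∑ k ∈ F, (G (k + fun p : T ↦ ((n.factorization p : ℕ) : ℤ)) * conj (G k) +
          G k * conj (G (k + fun p : T ↦ ((n.factorization p : ℕ) : ℤ)))).re) :
    (weilSemilocalQuadratic S g).re -
        (μ + ∑ n ∈ Finset.range (N + 1), |weilSemilocalCoeff S n - weilSemilocalCoeff S' n| *
          (3 * (π / 2 * (((n.factorization (s : ℕ) : ℕ) : ℝ) / ℓ)) ^ 2)) * ∫ u : ℝ, ‖g u‖ ^ 2 ≤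
      (weilSemilocalQuadratic S' g).re :=
  re_weilSemilocalQuadratic_ge_of_animalCert hT hT' hg hsupp hN fun u F G hGF hFw ↦
    latticeCert_of_blockCert (c := c) s (fun n ↦ weilSemilocalCoeff S n - weilSemilocalCoeff S' n) hℓ hℓ0 hblock u F G hGF hFw

end Summit.RiemannHypothesis.RiemannHypothesis.Theorems.SemilocalDeletionAnimalCert

end
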